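import Summits.CriticalPhenomena.PercolationContinuityZ3.Theorems.PercNearOneGluingNoHeavyQuantShapeHubLaws
import Summits.CriticalPhenomena.PercolationContinuityZ3.Theorems.PercNearOneGluingNoHeavyQuantBlobLawSizeBias
import HarnessLib

/-!
# QUANT lane R8, T-DEC: THE SUB-FLOOR HUB OF SHAPE `(lo, K)` IS A SHIFTED BLOB LAW — `sHub lo K P (lo·|P| + h) = blobLaw [(K, γ) : γ ∈ P] h`
# (census-1 gen 35; the bridge from gen 31's hubs to census-2's Poisson-binomial toolkit)

builds on p205010 (kernel theorem, internal audit signed; external expert review pending)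

Support file (`--supports stmt-CriticalPhenomena-4575`), QUANT lane seat prim-quant-census-1 (gen 35); memo
`run/shared/lean/prim/quant/prim-quant-census-1/g35/QUADHUB-G35.md` §4.  Theorems only (no definitions), standard axioms, no sorries.  Two recursions for
the same object: census-1 g31's `sHub lo K P` (`…QuantShapeHubLaws`: `sHub (γ :: P) = sHub P ∗ S(γ)`, `S(γ) = {lo: 1−γ, lo+K: γ}`) and census-2's
`blobLaw` (`…QuantSliceClosure`: `blobLaw ((K,γ) :: l) = slice (blobLaw l) K γ`).  Shifting by the deterministic part `lo·|P|` identifies them, so every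
Poisson-binomial lemma of census-2 (`pb_cons_succ`, `pb_ratio_mono`, `pb_size_bias_succ/fail`, `pb_reflection_capacity`, `heavy_blobLaw_…`,
`…QuantBlobLawSizeBias` ff.) applies to the hub masses `u(lo·j + K·t)`, and conversely gen 31's `sHub_mass_esL` / `sHub_struct` apply to equal-size blob
laws.  Intended use (memo §4 (2)): Poisson-ratio bounds for the hub masses in the every-width long-tail hub theorem.
* `sHub_eq_zero_below` — `sHub lo K P m = 0` for `m < lo·|P|`.
* **`sHub_shift_eq_blobLaw`** — `sHub lo K P (lo·|P| + h) = blobLaw (P.map (K, ·)) h` for every `h` (gates in `[0,1]`, `lo < K`).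
* **`sHub_atom_eq_pb`** — at the atoms: `sHub lo K P (lo·|P| + K·t) = blobLaw (P.map (K, ·)) (t·K)` (census-2's `P_G(t)` with `k = K`, `G = P`).

HONEST STATUS.  Bookkeeping bridge; `SiblingStep`, `GluedDominatedMass`, `SDECConvClosed`, `FarTreeRow` OPEN; RATE class (log\*) / honest sentence of
`run/shared/lean/prim/quant/README.md` unchanged.  [this work].  Nothing here is cited as a published result.  The gluing rows served
[cite: KozmaNitzan2024, Conjecture 3 (p. 15)]; product measure [cite: Grimmett1999, §1.3 p. 10].
-/

noncomputable section

open scoped BigOperators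

namespace Summit.CriticalPhenomena.PercolationContinuityZ3.Theorems
namespace Quant
namespace LawDec

/-- the FAR-GIANT PIECE of shape `(lo, K)`: `S(γ) = {lo: 1−γ, lo+K: γ}` -/
local notation3 "SP[" lo ", " K ", " a "]" => (fun h : ℕ => (1 - (a : ℝ)) * (if h = (lo : ℕ) then (1 : ℝ) else 0) +
  (a : ℝ) * (if h = (lo : ℕ) + (K : ℕ) then (1 : ℝ) else 0))

/-- the hub of shape `(lo, K)` (`lo < K`, gates in `[0,1]`) puts no mass below its bottom atom `lo·|P|`. [this work] -/
theorem sHub_eq_zero_below (lo K : ℕ) (hloK : lo < K) (P : List ℝ) (hP : ∀ γ ∈ P, 0 ≤ γ ∧ γ ≤ 1) (m : ℕ) (hm : m < lo * P.length) :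
    sHub lo K P m = 0 := by
  by_contra hne
  obtain ⟨s, hs, _⟩ := (sHub_struct lo K hloK 0 le_rfl P (fun γ hγ => ⟨(hP γ hγ).1, (hP γ hγ).2, by
    rw [zero_mul]; exact (hP γ hγ).1⟩)).1 m hne
  omega

/-- **THE HUB IS A SHIFTED BLOB LAW**: `sHub lo K P (lo·|P| + h) = blobLaw (P.map (K, ·)) h` for every `h` (`lo < K`, gates in `[0,1]`).  Induction on `P`:
both sides satisfy `F(γ :: P)(h) = (1−γ)·F(P)(h) + γ·[K ≤ h]·F(P)(h − K)` (`lconv_sp_apply` after the shift, resp. `slice`). [this work] -/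
theorem sHub_shift_eq_blobLaw (lo K : ℕ) (hloK : lo < K) : ∀ (P : List ℝ), (∀ γ ∈ P, 0 ≤ γ ∧ γ ≤ 1) → ∀ h : ℕ,
    sHub lo K P (lo * P.length + h) = blobLaw (P.map (fun γ => ((K : ℕ), γ))) h
  | [], _, h => by
    show (fun k : ℕ => if k = (0 : ℕ) then (1 : ℝ) else 0) (lo * 0 + h) = blobLaw [] h
    simp [blobLaw]
  | γ :: P, hP, h => by
    have hγ := hP γ (by simp)
    have hP' : ∀ γ' ∈ P, 0 ≤ γ' ∧ γ' ≤ 1 := fun γ' h' => hP γ' (List.mem_cons_of_mem γ h')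
    obtain ⟨_, aM, _, _⟩ := sHub_laws lo K P hP'
    have hdef : sHub lo K (γ :: P) = lconv ((lo + K) * P.length) (lo + K) (sHub lo K P) SP[lo, K, γ] := rfl
    have hrec : blobLaw (List.map (fun γ' => ((K : ℕ), γ')) (γ :: P)) = slice (blobLaw (List.map (fun γ' => ((K : ℕ), γ')) P)) K γ := rfl
    rw [hdef, lconv_sp_apply lo K ((lo + K) * P.length) (sHub lo K P) γ aM, hrec]
    simp only [slice, List.length_cons]
    have e1 : lo * (P.length + 1) + h - lo = lo * P.length + h := by
      rw [Nat.mul_succ]; omega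
    rw [if_pos (by rw [Nat.mul_succ]; omega), e1, sHub_shift_eq_blobLaw lo K hloK P hP' h]
    by_cases hK : K ≤ h
    · have e2 : lo * (P.length + 1) + h - (lo + K) = lo * P.length + (h - K) := by rw [Nat.mul_succ]; omega
      rw [if_pos (by rw [Nat.mul_succ]; omega), if_pos hK, e2, sHub_shift_eq_blobLaw lo K hloK P hP' (h - K)]
    · push Not at hK
      rw [if_neg (not_le.2 hK)]
      by_cases hle : lo + K ≤ lo * (P.length + 1) + h
      · rw [if_pos hle, sHub_eq_zero_below lo K hloK P hP' _ (by rw [Nat.mul_succ] at hle ⊢; omega)]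
      · rw [if_neg hle]

/-- **at the atoms**: `sHub lo K P (lo·|P| + K·t) = blobLaw (P.map (K, ·)) (t·K)` — census-2's Poisson-binomial point mass `P_G(t)` with `k = K`,
`G = P`. [this work] -/
theorem sHub_atom_eq_pb (lo K : ℕ) (hloK : lo < K) (P : List ℝ) (hP : ∀ γ ∈ P, 0 ≤ γ ∧ γ ≤ 1) (t : ℕ) :
    sHub lo K P (lo * P.length + K * t) = blobLaw (P.map (fun γ => ((K : ℕ), γ))) (t * K) := by
  rw [sHub_shift_eq_blobLaw lo K hloK P hP (K * t), Nat.mul_comm]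

end LawDec
end Quant
end Summit.CriticalPhenomena.PercolationContinuityZ3.Theorems
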